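import Summits.HodgeConjecture.CorCM.Stage4Interfaces
import Summits.HodgeConjecture.HodgeConjecture.Theorems.Ring2HypothesesDescentStandardBDischarged
import Literature.AlgebraicGeometry.HodgeTheory.FermatHodgeOfCMHodgeHypothesisModLiftSum
import HarnessLib

/-!
# Ring 2 — the stage-3 / stage-4 seam: side-rung SR-1 `HC_AV_of_B` is ring 2's `B`-chain

HONEST FRAMING (page 1, verbatim the cell's standing line): **research route conditional on HC_CM; not a
corollary; Q11.4-sentence-2 already refuted in dim ≥ 3.** Nothing in this file proves a case of the Hodge
conjecture; `HC_CM` (`Theses.RankFourFaces.CMAbelianHodge`) and `HC_AV`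
(`Theses.PadicSemiregularLift.HodgeAbelianVarieties`) occur BY NAME only, never restated, never asserted.

Stage 4 of the Hodge ladder (`CorCM/Stage4Interfaces.lean`, scoping file of the literature seat
`hodge-director-lit-stage4`) takes ring 2's conclusion BY NAME (`CorCM.Stage4.HC_AV` is an `abbrev` of
`Theses.PadicSemiregularLift.HodgeAbelianVarieties`, `hc_av_iff` is `Iff.rfl`) and records, among its
`@[conjecture]` junction shapes, the conditions→object side-rung

  `CorCM.Stage4.HC_AV_of_B : (∀ d Z η, IsSmoothProjective d Z → StandardConjectureBStar d Z η) → HC_AV`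

"to be PROVED in the tree from the André files; not asserted". This file is ring 2's kernel countersign
of that seam: the junction IS row 4 of the ring-2 `B`-ledger
(`Ring2.Hypotheses.hc_av_of_standardConjectureB_of_andre_discharged`, binder `hB` = row b10 of
`BINDER-OWNERS.md`, with André 1996 §2.1 DISCHARGED by
`Theorems.Andre1996_motivatedClasses_le_algebraicClasses_of_standardConjectureB_holds`), so that

* `hc_av_of_B_of_motivatedImpliesAlgebraicAV` — FACT-FREE: SR-1 follows from the single ring-2 edge
  `MotivatedImpliesAlgebraicAV → HC_AV` (binder b05 ⟹ `HC_AV`), because `B` for all smooth projective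
  complex varieties already gives `MotivatedImpliesAlgebraicAV` in the kernel
  (`motivatedImpliesAlgebraicAV_of_standardConjectureB_discharged`);
* `hc_av_of_B_of_andre1996` — SR-1 HOLDS MODULO ONE refereed named fact, André 1996 Thm. 0.6.2
  (`HodgeTheory.Andre1996_hodgeClasses_abelianVariety_motivated`, C-row c2 of `BINDER-OWNERS.md`; a
  hypothesis in Lean, not discharged: partial discharges `…_of_middle_range`, `…_of_pencils` only).

(That the same antecedent also yields stage 2's target is already the tree's
`hc_cm_of_standardConjectureB_of_andre_discharged`; `HC_CM` is not an input anywhere here.)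

No definition, no new named fact, no `sorry`; 0 lines of mathematics beyond term reuse — the point is the
IDENTITY of declarations across the seam (stage 4's `HC_AV`/`HC_CM` are ring 2's / stage 2's declarations,
and SR-1's antecedent is symbol for symbol the inline binder `hB` of row b10).

References (bib keys): Andre1996Motifs (§0.3 p. 7, §2.1 p. 14, Thm. 0.6.2 p. 9), Grothendieck1968 (§3,
B(X)), Lieberman1968 (Thm. 3).
-/

set_option linter.dupNamespace false

noncomputable section

namespace Summit.HodgeConjecture.HodgeConjecture.Ring2.Hypotheses

open Literature.AlgebraicGeometry Literature.AlgebraicGeometry.Motives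
open Literature.AlgebraicGeometry.HodgeTheory
open Summit.HodgeConjecture.CorCM

/-- **SR-1 from the ring-2 edge `MotivatedImpliesAlgebraicAV → HC_AV`, fact-free.** Granted that motivated
classes on complex abelian varieties being algebraic implies `HC_AV` (the b05 ⟹ `HC_AV` edge; in print André
1996 Thm. 0.6.2), the stage-4 side-rung `HC_AV_of_B` holds: `B` for every smooth projective complex variety
gives `MotivatedImpliesAlgebraicAV` in the kernel (`motivatedImpliesAlgebraicAV_of_standardConjectureB_discharged`,
André §2.1 discharged in the tree). [cite: Andre1996Motifs, §2.1 remark following Déf. 1 (p. 14) and §0.3 (p. 7)]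
[cite: Grothendieck1968, §3 p. 196 (B(X))] -/
theorem hc_av_of_B_of_motivatedImpliesAlgebraicAV
    (h : MotivatedImpliesAlgebraicAV → Theses.PadicSemiregularLift.HodgeAbelianVarieties) :
    Stage4.HC_AV_of_B :=
  fun hB => h (motivatedImpliesAlgebraicAV_of_standardConjectureB_discharged hB)

/-- **SR-1 (`CorCM.Stage4.HC_AV_of_B`) modulo André 1996 Thm. 0.6.2** — the stage-4 junction "`B` for all
smooth projective complex varieties ⟹ `HC_AV`" IS row 4 of the ring-2 `B`-ledger
(`hc_av_of_standardConjectureB_of_andre_discharged`): its antecedent is symbol for symbol the inline binder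
`hB` (row b10), and the only named fact left is `Andre1996_hodgeClasses_abelianVariety_motivated` (Hodge
classes on complex abelian varieties are motivated; refereed, a hypothesis in Lean — CONDITIONAL result).
[cite: Andre1996Motifs, Thm. 0.6.2 (p. 9) and §2.1 (p. 14)] [cite: Grothendieck1968, §3 p. 196 (B(X))] -/
theorem hc_av_of_B_of_andre1996 (hAM : Andre1996_hodgeClasses_abelianVariety_motivated) :
    Stage4.HC_AV_of_B :=
  fun hB => hc_av_of_standardConjectureB_of_andre_discharged hB hAM

/-! ### Row 4 of stage 4 (Fermat hypersurfaces) with its two Jacobian binders discharged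

Appended 2026-08-21 (ring2-b01 gen 41). `CorCM.Stage4.hc_fermat_of_hc_cm` (`Stage4Interfaces.lean`, row 4)
displays, besides `HC_CM` and Shioda–Katsura's lift `hSK : FermatHodgeClassesLiftToCurvePowersSum`, two
further printed inputs as Lean hypotheses: `hJ` (Koblitz–Rohrlich 1978: Fermat Jacobians are of CM type)
and `hJex : Motives.nonempty_jacobian_of_isSmoothProjective.{0}` (Milne 1986 Thm. 1.1, Jacobians exist
over every field). Both are THEOREMS of the tree at the only place row 4 uses them — the complex Fermat
curve: `isOfCMType_jacobian_fermatCurve` (`HodgeTheory/FermatCurveJacobianCMType`) and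
`Motives.nonempty_jacobian_of_isSmoothProjective_complex` (`Motives/JacobianExistenceComplex`, Serre's
criterion), assembled by the literature lane in
`HodgeTheory/FermatHodgeOfCMHodgeHypothesisModLiftSum` (`hodgeConjectureFor_fermat_of_cmHodgeHypothesis_of_liftSum_pos`,
`hodgeFermatVarieties_of_cmHodgeHypothesis_of_liftSum`). Ring 2's countersign of row 4 is therefore:
**row 4 ⟸ `HC_CM` ∧ `hSK` alone** — `HC_CM` BY NAME (`CorCM.HC_CM` =
`Theses.RankFourFaces.CMAbelianHodge`, junction `hc_cm_iff_forall_cmHodgeHypothesisAt` = `Iff.rfl`), one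
printed record (`hSK`), no Jacobian binder; and the conclusion for every degree `m` is literally the route
item `Theses.PadicSemiregularLift.HodgeFermatVarieties`. Term reuse only; nothing about `HC_AV` changes. -/

/-- **Stage 4, row 4, with `hJ` and `hJex` discharged: `HC_CM ∧ hSK ⟹ HC(X)` for every complex Fermat
variety `X` of positive degree.** Same conclusion as `CorCM.Stage4.hc_fermat_of_hc_cm`, with the binders
`hJ` (Fermat Jacobians are CM — the tree's `isOfCMType_jacobian_fermatCurve`) and `hJex` (Jacobians exist —
used only over `ℂ`, where it is `Motives.nonempty_jacobian_of_isSmoothProjective_complex`) no longer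
displayed: `hodgeConjectureFor_fermat_of_cmHodgeHypothesis_of_liftSum_pos` under the junction
`hc_cm_iff_forall_cmHodgeHypothesisAt`. CONDITIONAL on `HC_CM` (by name) and on the record `hSK`
(Shioda–Katsura 1979 Thm. 1.7 / Prop. 2.4 in Hodge-class form). [cite: ShiodaKatsura1979, §1 Thm. 1.7 and §2 Prop. 2.4 (2.5)]
[cite: Shioda1979HodgeFermat, Thm. I] [cite: KoblitzRohrlich1978, §1 pp. 1183–1184]
[cite: Milne1986JacobianVarieties, Thm. 1.1] -/
theorem hc_fermat_of_hc_cm_of_liftSum (hCM : Summit.HodgeConjecture.CorCM.HC_CM)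
    (hSK : FermatHodgeClassesLiftToCurvePowersSum) :
    ∀ (n m : ℕ) (X : SchemeOver ℂ), 1 ≤ m → Motives.IsFermatVariety n m X → IsSmoothProjective n X →
      HodgeConjectureFor n X :=
  hodgeConjectureFor_fermat_of_cmHodgeHypothesis_of_liftSum_pos
    (Summit.HodgeConjecture.CorCM.hc_cm_iff_forall_cmHodgeHypothesisAt.mp hCM) hSK

/-- **Stage 4's row 4 as the route item: `HC_CM ∧ hSK ⟹ Theses.PadicSemiregularLift.HodgeFermatVarieties`**
(every `n`, EVERY degree `m` — `m = 0` is vacuous, `V₊(n + 2) = ∅` is not smooth projective), BY NAME on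
both sides: the antecedent is `CorCM.HC_CM` (= `Theses.RankFourFaces.CMAbelianHodge`), the consequent is the
route declaration (stmt-HodgeConjecture-1334) unfolded by `Iff.rfl`; the only printed record left is `hSK`.
`hodgeFermatVarieties_of_cmHodgeHypothesis_of_liftSum` under the junction. CONDITIONAL on `HC_CM` and `hSK`.
[cite: ShiodaKatsura1979, §1 Thm. 1.7 and §2 Prop. 2.4 (2.5)] [cite: Shioda1979HodgeFermat, Thm. I] -/
theorem hodgeFermatVarieties_of_hc_cm_of_liftSum (hCM : Summit.HodgeConjecture.CorCM.HC_CM)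
    (hSK : FermatHodgeClassesLiftToCurvePowersSum) :
    Theses.PadicSemiregularLift.HodgeFermatVarieties :=
  hodgeFermatVarieties_of_cmHodgeHypothesis_of_liftSum
    (Summit.HodgeConjecture.CorCM.hc_cm_iff_forall_cmHodgeHypothesisAt.mp hCM) hSK

/-- **The exact shape of row 4 over the seam: `HC_CM → (hSK → HodgeFermatVarieties)`** — stage 2's target
BY NAME implies stage 4's Fermat row modulo the single record `hSK`, with no Jacobian binder (the form a
`ClosesWithCM`-style ledger line would take; recorded for the dictionary, term reuse).
[cite: ShiodaKatsura1979, §1 Thm. 1.7 and §2 Prop. 2.4 (2.5)] -/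
theorem hc_cm_implies_hodgeFermatVarieties_mod_liftSum :
    Summit.HodgeConjecture.CorCM.HC_CM → FermatHodgeClassesLiftToCurvePowersSum →
      Theses.PadicSemiregularLift.HodgeFermatVarieties :=
  hodgeFermatVarieties_of_hc_cm_of_liftSum

end Summit.HodgeConjecture.HodgeConjecture.Ring2.Hypotheses

end
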